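/-
Copyright (c) 2026. All rights reserved.
Released under Apache 2.0 license as described in the file LICENSE.
Authors: abc-iut cell, seat abc-iut-f-069 (gen 7; row «CT2b / G-L4t6g8-2 residual», file 2 of 5).
-/
import Literature.AnabelianGeometry.AbsoluteAnabelian.AbsTopII.DehnTwistFixedSubgroupExotic
import Literature.GroupTheory.CombinatorialGroupTheory.FoxChainPushforward
import HarnessLib

/-!
# Level-by-level Fox chains of an element of `F̂₂` over finite quotients (Fox calculus bookkeeping)

Lyndon–Schupp, *Combinatorial Group Theory*, Ch. II §3 (Fox derivations, the fundamental formula, the chain rule)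
[cite: LyndonSchupp2001, Ch. II §3]; consumed for S. Mochizuki, *Topics in Absolute Anabelian Geometry II*
[AbsTopII] (`MochizukiAbsTopII2013`) Prop 1.3 (viii) p. 12 at the nodal Dehn-twist datum (abc-iut-L4-t6
`DehnTwistLoopDatum`: `Π_𝔾 = F̂₂ = ⟨a,b⟩^`, `Π_I = F̂₂ ⋊_{shear^i} Ẑ`, `Π_e = b^Ẑ`, `Π_v = ⟨b^Ẑ, ab^Ẑa⁻¹⟩^`).

PROOF-ONLY file (no definition, no instance, no notation), abc-iut-f-069 (gen 7); file 2 of the chain closing the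
residual «CT2» of GAP row G-L4t6g8-2 (the displayed hypothesis of abc-iut-L4-t6's `prop_1_3_viii′_dpsc_of_CT2`,
p487638; the non-integral-slope half is L4-t6's `DehnTwistMixedTwistNonIntegral`, p489641).  ROUTE of the chain: the
Fox `a`-chain of `x ∈ F̂₂` read in a finite quotient `G` of `Π_I` is a coefficient function `f : G → k`; these are
COMPATIBLE under pushforward (a `Ẑ`-valued measure on `Π_I`), and the CT2 equation "`conj(z)` fixes `x`"
(`z = (b^u, k) ∈ D_e`) makes every `f` INVARIANT under the affine permutation `h ↦ z̄ h τ̄⁻¹` (`τ = (1,k)`); a free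
pro-cyclic dynamics admits no non-zero invariant `𝔽_ℓ`-chain (files 3–4).  THIS file: for an ARBITRARY finite group
`G` and a continuous Fox homomorphism `Φ : F̂₂ → W(G,k) = (k^G × k^G) ⋊ G` with `a ↦ wa α`, `b ↦ wb β` (abc-iut-f-069
`FoxPathChains` p478344, `FoxChainPushforward` p495153):
* `fox_mem_pathSub` / `fox_bd_eq` — every `Φ x` is a path chain (fundamental formula); `fox_right_eq`;
* `fox_eq_mapW` / `fox_fst_eq_push` — **compatibility of levels** along `ρ : G' →* G`: `Φ = mapW ρ ∘ Φ'`;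
* `fox_bPow_fst_eq_zero`, `fox_bPow_eq_pow` — `b`-powers (`t ∈ Ẑ`) carry no `a`-chain; `Φ(b^t) = (wb β)^n`;
* `fox_shearEnd_eq` — **chain rule for the shear** `a ↦ a b^κ` at a level where it acts through an automorphism
  `γ` (`γ α = α β^n`, `γ β = β`): `Φ ∘ shear_κ = mapW γ ∘ thetaHom(αβ^{-n}, β, n) ∘ Φ`;
* `fox_fst_invariant_of_conj_shear_eq` — **INVARIANCE** of the `a`-chain `f` of `x` under `h ↦ β^{n_u} γ(h)` when
  `shear_κ x = b^{-u} x b^{u}`; `fox_fst_comp_eq_of_shear_eq_mul_bPow` — under `γ` when `shear_κ y = y b^{P}`;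
* `right_mem_zpowers_of_fst_eq_zero`, `right_mem_or_exists_of_fst_eq_zero_off` — **read-outs of the fundamental
  formula** summed over the coset `x̄⟨β⟩`: `f = 0 ⇒ x̄ ∈ ⟨β⟩`; `f = 0` off a subgroup `Q ∋ β ⇒ x̄ ∈ Q ∪ Q α ⟨β⟩`.
HONEST FRAMING: classical profinite group theory (free profinite groups, finite quotients, Fox calculus) under OUR
kernel check, for a constructed model (constructed ≠ geometric); nothing here bears on [IUTchIII] Cor 3.12; no side taken.
-/

noncomputable section

open scoped Pointwise

namespace Literature.AnabelianGeometry.AbsoluteAnabelian.AbsTopII.DehnTwist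

open Literature.AnabelianGeometry.EtaleTheta.SettingModel
open Literature.AnabelianGeometry.EtaleTheta
open Literature.GroupTheory.CombinatorialGroupTheory.FoxChain
open Literature.AnabelianGeometry.SemiGraphs.SemiGraphOfAnabelioids.IsProSigmaCompletion (zhat_monoidHom_apply_eq_pow)
open Function _root_.Topology

/-! ### §0 Algebra in the Fox group `W = (k^G × k^G) ⋊ G` -/
section WAlgebra
variable {G : Type*} [Group G] {k : Type*} [CommRing k]

/-- The elements of `W` with ZERO `a`-chain form a subgroup. [cite: LyndonSchupp2001, Ch. II §3] -/
theorem fst_eq_zero_mul {w w' : W G k} (hw : (Multiplicative.toAdd w.left).1 = 0)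
    (hw' : (Multiplicative.toAdd w'.left).1 = 0) : (Multiplicative.toAdd (w * w').left).1 = 0 := by
  rw [SemidirectProduct.mul_left, toAdd_mul, toAdd_foxAct, Prod.fst_add, hw, hw', lt_zero, add_zero]


/-- The elements of `W` with zero `a`-chain are closed under inversion. [cite: LyndonSchupp2001, Ch. II §3] -/
theorem fst_eq_zero_inv {w : W G k} (hw : (Multiplicative.toAdd w.left).1 = 0) :
    (Multiplicative.toAdd w⁻¹.left).1 = 0 := by
  rw [SemidirectProduct.inv_left, toAdd_foxAct, toAdd_inv, Prod.fst_neg, hw, neg_zero, lt_zero]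


/-- `thetaHom` does not change the `a`-chain. [cite: LyndonSchupp2001, Ch. II §3] -/
theorem thetaHom_fst (A B : G) (M : ℕ) (w : W G k) :
    (Multiplicative.toAdd (thetaHom A B M w).left).1 = (Multiplicative.toAdd w.left).1 := by
  rw [thetaHom_apply]; rfl


/-- `thetaHom` does not change the `G`-component. [cite: LyndonSchupp2001, Ch. II §3] -/
theorem thetaHom_right (A B : G) (M : ℕ) (w : W G k) : (thetaHom A B M w).right = w.right := by
  rw [thetaHom_apply]


/-- Conjugating by an element with zero `a`-chain LEFT-TRANSLATES the `a`-chain: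
`(w₁ w w₁⁻¹).left.1 = λ_{w₁.right} (w.left.1)`. [cite: LyndonSchupp2001, Ch. II §3] -/
theorem fst_conj_of_fst_eq_zero (w₁ w : W G k) (hw₁ : (Multiplicative.toAdd w₁.left).1 = 0) :
    (Multiplicative.toAdd (w₁ * w * w₁⁻¹).left).1 = lt w₁.right (Multiplicative.toAdd w.left).1 := by
  rw [SemidirectProduct.mul_left, SemidirectProduct.mul_left, SemidirectProduct.inv_left,
    SemidirectProduct.mul_right, toAdd_mul, toAdd_mul, toAdd_foxAct, toAdd_foxAct, toAdd_foxAct, toAdd_inv]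
  simp only [Prod.fst_add, Prod.fst_neg, hw₁, neg_zero, lt_zero, zero_add, add_zero]


/-- The `G`-component of `(wb β)^n` is `β^n`. [cite: LyndonSchupp2001, Ch. II §3] -/
theorem wb_pow_right [DecidableEq G] (β : G) (n : ℕ) : (wb β ^ n : W G k).right = β ^ n :=
  congrArg SemidirectProduct.right (wb_pow (k := k) β n)


/-- `(wb β)^n` has zero `a`-chain. [cite: LyndonSchupp2001, Ch. II §3] -/
theorem wb_pow_fst [DecidableEq G] (β : G) (n : ℕ) : (Multiplicative.toAdd (wb β ^ n : W G k).left).1 = 0 := by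
  rw [wb_pow]; rfl


/-- Normal form of `wa α · (wb β)^n`. [cite: LyndonSchupp2001, Ch. II §3] -/
theorem wa_mul_wb_pow [DecidableEq G] (α β : G) (n : ℕ) :
    (wa α * wb β ^ n : W G k) =
      ⟨Multiplicative.ofAdd (e 1, ∑ l ∈ Finset.range n, e (α * β ^ l)), α * β ^ n⟩ := by
  rw [wb_pow, wa]
  refine SemidirectProduct.ext ?_ rfl
  rw [SemidirectProduct.mul_left, foxAct_apply, ← ofAdd_add, Prod.mk_add_mk]
  simp only [lt_zero, lt_sum, lt_e, add_zero, zero_add]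


/-- The left coset `X⟨β⟩` as a finite set, and its two invariances. [cite: LyndonSchupp2001, Ch. II §3] -/
theorem exists_coset_finset [Fintype G] (X β : G) : ∃ S : Finset G, (∀ q, q ∈ S ↔ X⁻¹ * q ∈ Subgroup.zpowers β) ∧
    (∀ q, q ∈ S ↔ q * β⁻¹ ∈ S) := by
  classical
  refine ⟨Finset.univ.filter fun q => X⁻¹ * q ∈ Subgroup.zpowers β, fun q => by simp, fun q => ?_⟩
  simp only [Finset.mem_filter, Finset.mem_univ, true_and]
  rw [← mul_assoc]
  constructor
  · intro hq; exact Subgroup.mul_mem _ hq (Subgroup.inv_mem _ (Subgroup.mem_zpowers β))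
  · intro hq
    have := Subgroup.mul_mem _ hq (Subgroup.mem_zpowers β)
    rwa [inv_mul_cancel_right] at this


/-- The Fox group over a finite group with finite coefficients is finite. [cite: LyndonSchupp2001, Ch. II §3] -/
theorem finite_W [Finite G] [Finite k] : Finite (W G k) := by
  haveI : Finite (Multiplicative (V2 G k) × G) := by
    change Finite (((G → k) × (G → k)) × G)
    infer_instance
  exact Finite.of_injective (fun w : W G k => (w.left, w.right))
    (fun w w' h => SemidirectProduct.ext (congrArg Prod.fst h) (congrArg Prod.snd h))

end WAlgebra

/-! ### §1 Fox homomorphisms at an arbitrary finite level -/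
section Level
variable {G : Type} [Group G] [DecidableEq G]
variable {k : Type} [CommRing k] [TopologicalSpace (W G k)] [DiscreteTopology (W G k)]
variable {α β : G} {Φ : F₂hatT →ₜ* W G k}

/-- **The Fox homomorphism at a finite level exists**: a continuous `Φ : F̂₂ → W(G,k)` with `a ↦ wa α`, `b ↦ wb β`
(universal property of the profinite completion `F̂₂` into the finite group `W`). [cite: LyndonSchupp2001, Ch. II §3] -/
theorem exists_fox [Finite (W G k)] (α β : G) : ∃ Φ : F₂hatT →ₜ* W G k, Φ genA = wa α ∧ Φ genB = wb β := by
  obtain ⟨Φ, hΦ⟩ := exists_continuousMonoidHom_extend F₂ (W G k) (FreeGroup.lift ![wa α, wb β])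
  refine ⟨Φ, ?_, ?_⟩
  · show Φ (eta (FreeGroup.of 0)) = wa α
    rw [eta_apply, hΦ, FreeGroup.lift_apply_of]
    rfl
  · show Φ (eta (FreeGroup.of 1)) = wb β
    rw [eta_apply, hΦ, FreeGroup.lift_apply_of]
    rfl

/-- Every `Φ x` is a PATH CHAIN (the fundamental formula; closed condition, true on the dense `F₂`). [cite: LyndonSchupp2001, Ch. II §3] -/
theorem fox_mem_pathSub (hΦa : Φ genA = wa α) (hΦb : Φ genB = wb β) (x : F₂hatT) : Φ x ∈ pathSub α β := by
  let D : Subgroup F₂hatT := (pathSub α β).comap Φ.toMonoidHom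
  have hD : IsClosed (D : Set F₂hatT) := by
    change IsClosed (Φ ⁻¹' ((pathSub α β : Subgroup (W G k)) : Set _))
    exact (isClosed_discrete _).preimage Φ.continuous
  have h0 : genA ∈ D := by
    show Φ genA ∈ pathSub α β
    rw [hΦa]; exact wa_mem_pathSub α β
  have h1 : genB ∈ D := by
    show Φ genB ∈ pathSub α β
    rw [hΦb]; exact wb_mem_pathSub α β
  have hDtop := subgroup_eq_top_of_isClosed_of_gen_mem D hD h0 h1
  have hx : x ∈ D := hDtop ▸ Subgroup.mem_top x
  exact hx

/-- The path-chain identity of `Φ x`, unfolded. [cite: LyndonSchupp2001, Ch. II §3] -/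
theorem fox_bd_eq (hΦa : Φ genA = wa α) (hΦb : Φ genB = wb β) (x : F₂hatT) :
    rt α (Multiplicative.toAdd (Φ x).left).1 - (Multiplicative.toAdd (Φ x).left).1 +
      (rt β (Multiplicative.toAdd (Φ x).left).2 - (Multiplicative.toAdd (Φ x).left).2) = e (Φ x).right - e 1 :=
  fox_mem_pathSub hΦa hΦb x

/-- The `G`-component of `Φ` is the continuous `F̂₂ → G` with `a ↦ α`, `b ↦ β`. [cite: LyndonSchupp2001, Ch. II §3] -/
theorem fox_right_eq [TopologicalSpace G] [DiscreteTopology G] (hΦa : Φ genA = wa α) (hΦb : Φ genB = wb β)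
    {φ : F₂hatT →ₜ* G} (hφa : φ genA = α)
    (hφb : φ genB = β) (x : F₂hatT) : (Φ x).right = φ x := by
  let ρW : W G k →ₜ* G := ⟨SemidirectProduct.rightHom, continuous_of_discreteTopology⟩
  have h : ρW.comp Φ = φ := by
    refine ext_of_eta ?_ ?_
    · show SemidirectProduct.rightHom (Φ genA) = φ genA
      rw [hΦa, hφa]; rfl
    · show SemidirectProduct.rightHom (Φ genB) = φ genB
      rw [hΦb, hφb]; rfl
  exact DFunLike.congr_fun h x

/-- **Compatibility of levels**: along `ρ : G' →* G` with `ρ α' = α`, `ρ β' = β`, `Φ = mapW ρ ∘ Φ'` (the chains at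
level `G` are the pushforwards of the chains at level `G'`). [cite: LyndonSchupp2001, Ch. II §3] -/
theorem fox_eq_mapW (hΦa : Φ genA = wa α) (hΦb : Φ genB = wb β)
    {G' : Type} [Group G'] [Fintype G'] [DecidableEq G'] [TopologicalSpace (W G' k)] [DiscreteTopology (W G' k)]
    {α' β' : G'} {Φ' : F₂hatT →ₜ* W G' k} (hΦ'a : Φ' genA = wa α') (hΦ'b : Φ' genB = wb β')
    (ρ : G' →* G) (hρa : ρ α' = α) (hρb : ρ β' = β) (x : F₂hatT) : Φ x = mapW ρ (Φ' x) := by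
  let M : W G' k →ₜ* W G k := ⟨mapW ρ, continuous_of_discreteTopology⟩
  have h : Φ = M.comp Φ' := by
    refine ext_of_eta ?_ ?_
    · show Φ genA = mapW ρ (Φ' genA)
      rw [hΦa, hΦ'a, mapW_wa, hρa]
    · show Φ genB = mapW ρ (Φ' genB)
      rw [hΦb, hΦ'b, mapW_wb, hρb]
  exact DFunLike.congr_fun h x

/-- The `a`-chain at level `G` is the pushforward of the `a`-chain at level `G'`. [cite: LyndonSchupp2001, Ch. II §3] -/
theorem fox_fst_eq_push (hΦa : Φ genA = wa α) (hΦb : Φ genB = wb β)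
    {G' : Type} [Group G'] [Fintype G'] [DecidableEq G'] [TopologicalSpace (W G' k)] [DiscreteTopology (W G' k)]
    {α' β' : G'} {Φ' : F₂hatT →ₜ* W G' k} (hΦ'a : Φ' genA = wa α') (hΦ'b : Φ' genB = wb β')
    (ρ : G' →* G) (hρa : ρ α' = α) (hρb : ρ β' = β) (x : F₂hatT) :
    (Multiplicative.toAdd (Φ x).left).1 = push ρ (Multiplicative.toAdd (Φ' x).left).1 := by
  rw [fox_eq_mapW hΦa hΦb hΦ'a hΦ'b ρ hρa hρb x, toAdd_mapW_left]

/-- **`b`-powers have zero `a`-chain** (`t ∈ Ẑ`; true on `η(b)^ℤ`, closed condition). [cite: LyndonSchupp2001, Ch. II §3] -/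
theorem fox_bPow_fst_eq_zero (hΦb : Φ genB = wb β) (t : ZH) : (Multiplicative.toAdd (Φ (bPow t)).left).1 = 0 := by
  -- the subgroup of `W` with zero first chain, pulled back along `Φ ∘ bPow`
  let S : Subgroup (W G k) :=
    { carrier := {w | (Multiplicative.toAdd w.left).1 = 0}
      one_mem' := by show (Multiplicative.toAdd (1 : W G k).left).1 = 0; rfl
      mul_mem' := fun hw hw' => fst_eq_zero_mul hw hw'
      inv_mem' := fun hw => fst_eq_zero_inv hw }
  let D : Subgroup ZH := S.comap (Φ.toMonoidHom.comp bPow.toMonoidHom)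
  have hD : IsClosed (D : Set ZH) := by
    change IsClosed ((fun t => Φ (bPow t)) ⁻¹' (S : Set (W G k)))
    exact (isClosed_discrete _).preimage (Φ.continuous.comp bPow.continuous)
  have h1 : iotaZ (Multiplicative.ofAdd 1) ∈ D := by
    show (Multiplicative.toAdd (Φ (bPow (iotaZ (Multiplicative.ofAdd 1)))).left).1 = 0
    rw [bPow_iotaZ_one]
    change (Multiplicative.toAdd (Φ genB).left).1 = 0
    rw [hΦb]; rfl
  have hzp : (Subgroup.zpowers (iotaZ (Multiplicative.ofAdd 1)) : Set ZH) ⊆ D := by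
    intro s hs
    exact (Subgroup.zpowers_le.mpr h1) hs
  have hdense := ZHatCompletion.dense_zpowers_eta_one
  have hall : (Set.univ : Set ZH) ⊆ D := by
    rw [← hdense.closure_eq]
    exact closure_minimal hzp hD
  exact hall (Set.mem_univ t)

omit [DiscreteTopology (W G k)] in
/-- **`Φ(b^t)` is a power of `wb β`**: if `W` is killed by `N`-th powers then `Φ (b^t) = (wb β)^{(t mod N)}` (a
homomorphism `Ẑ → W` into a group of exponent `N` only sees `t` modulo `N`). [cite: RibesZalesskii2010, Thm 2.7.1] -/
theorem fox_bPow_eq_pow (hΦb : Φ genB = wb β) (N : ℕ+) (hN : ∀ w : W G k, w ^ (N : ℕ) = 1) (t : ZH) :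
    Φ (bPow t) = wb β ^ (Multiplicative.toAdd (ZHatLevel.level N t)).val := by
  have h := zhat_monoidHom_apply_eq_pow (Φ.toMonoidHom.comp bPow.toMonoidHom) N hN t
  have h1 : (Φ.toMonoidHom.comp bPow.toMonoidHom) (ZHatLevel.eta 1) = wb β := by
    show Φ (bPow (ZHatLevel.eta 1)) = wb β
    rw [← iotaZ_one_eq, bPow_iotaZ_one]
    exact hΦb
  rw [h1] at h
  exact h

/-! ### The chain rule for the shear at a non-trivial level, and the two invariance statements -/

/-- **Chain rule for the shear `a ↦ a b^κ`, `b ↦ b` at a level where it acts through the automorphism `γ`**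
(`γ α = α β^n`, `γ β = β`, `Φ(b^κ) = (wb β)^n`): `Φ ∘ shear_κ = mapW γ ∘ thetaHom(α β^{-n}, β, n) ∘ Φ` — two continuous
homomorphisms `F̂₂ → W` agreeing on `a` and `b`. [cite: LyndonSchupp2001, Ch. II §3] -/
theorem fox_shearEnd_eq [Fintype G] (hΦa : Φ genA = wa α) (hΦb : Φ genB = wb β) (κ : ZH) (γ : G →* G) (n : ℕ)
    (hγa : γ α = α * β ^ n) (hγb : γ β = β) (hκ : Φ (bPow κ) = wb β ^ n) (x : F₂hatT) :
    Φ (shearEnd κ x) = mapW γ (thetaHom (α * (β ^ n)⁻¹) β n (Φ x)) := by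
  let M : W G k →ₜ* W G k := ⟨(mapW γ).comp (thetaHom (α * (β ^ n)⁻¹) β n), continuous_of_discreteTopology⟩
  have h : Φ.comp (shearEnd κ) = M.comp Φ := by
    refine ext_of_eta ?_ ?_
    · show Φ (shearEnd κ (eta (FreeGroup.of 0))) = mapW γ (thetaHom (α * (β ^ n)⁻¹) β n (Φ (eta (FreeGroup.of 0))))
      rw [shearEnd_eta_of_zero, map_mul, hκ, show Φ (eta (FreeGroup.of 0)) = wa α from hΦa, wa_mul_wb_pow,
        thetaHom_apply, wa]
      refine SemidirectProduct.ext ?_ ?_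
      · apply Multiplicative.toAdd.injective
        rw [toAdd_mapW_left]
        simp only [toAdd_ofAdd, push_e, map_one, zero_add, push_sum, rt_e, one_mul, map_mul, map_pow, map_inv,
          hγa, hγb]
        refine Prod.ext rfl ?_
        dsimp only
        refine Finset.sum_congr rfl fun j _ => ?_
        congr 1
        group
      · show α * β ^ n = γ α
        rw [hγa]
    · show Φ (shearEnd κ (eta (FreeGroup.of 1))) = mapW γ (thetaHom (α * (β ^ n)⁻¹) β n (Φ (eta (FreeGroup.of 1))))
      rw [shearEnd_eta_of_one, show Φ (eta (FreeGroup.of 1)) = wb β from hΦb, thetaHom_wb, mapW_wb, hγb]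
  exact DFunLike.congr_fun h x

/-- **INVARIANCE (centraliser form).** If `shear_κ x = b^{-u} x b^{u}` (the CT2 equation: `conj(b^u) ∘ shear_κ` fixes
`x`) then the `a`-chain `f` of `x` satisfies `f (β^{n_u} · γ h) = f h` (`Φ(b^u) = (wb β)^{n_u}`). [cite: LyndonSchupp2001, Ch. II §3] -/
theorem fox_fst_invariant_of_conj_shear_eq [Fintype G] (hΦa : Φ genA = wa α) (hΦb : Φ genB = wb β) (κ u : ZH)
    (γ : G ≃* G) (n nu : ℕ) (hγa : γ α = α * β ^ n) (hγb : γ β = β) (hκ : Φ (bPow κ) = wb β ^ n)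
    (hu : Φ (bPow u) = wb β ^ nu) {x : F₂hatT} (hx : shearEnd κ x = (bPow u)⁻¹ * x * bPow u) (h : G) :
    (Multiplicative.toAdd (Φ x).left).1 (β ^ nu * γ h) = (Multiplicative.toAdd (Φ x).left).1 h := by
  set f := (Multiplicative.toAdd (Φ x).left).1 with hfdef
  -- `x = b^u · shear_κ x · b^{-u}`, so `Φ x` is the conjugate by `Φ(b^u)` of the transported chain
  have hx' : x = bPow u * shearEnd κ x * (bPow u)⁻¹ := by rw [hx]; group
  have hΦx : Φ x = Φ (bPow u) * mapW γ.toMonoidHom (thetaHom (α * (β ^ n)⁻¹) β n (Φ x)) * (Φ (bPow u))⁻¹ := by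
    conv_lhs => rw [hx']
    rw [map_mul, map_mul, map_inv, fox_shearEnd_eq hΦa hΦb κ γ.toMonoidHom n (by exact hγa) (by exact hγb) hκ x]
  have h0 := congrArg (fun w : W G k => (Multiplicative.toAdd w.left).1) hΦx
  have h1 : (Multiplicative.toAdd (Φ (bPow u) * mapW γ.toMonoidHom (thetaHom (α * (β ^ n)⁻¹) β n (Φ x)) *
      (Φ (bPow u))⁻¹).left).1 = lt (β ^ nu) (push (⇑γ) f) := by
    rw [fst_conj_of_fst_eq_zero _ _ (fox_bPow_fst_eq_zero hΦb u), hu, wb_pow_right, toAdd_mapW_left]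
    show lt (β ^ nu) (push (⇑γ.toMonoidHom) (Multiplicative.toAdd (thetaHom (α * (β ^ n)⁻¹) β n (Φ x)).left).1) = _
    rw [thetaHom_fst]
    rfl
  have hf : f = lt (β ^ nu) (push (⇑γ) f) := h0.trans h1
  -- evaluate at `β^{n_u} · γ h`
  have h2 := congrFun hf (β ^ nu * γ h)
  rw [h2, lt_apply, inv_mul_cancel_left]
  exact push_apply_of_injective (⇑γ) γ.injective f h

/-- **INVARIANCE (twisted fixed-point form).** If `shear_κ y = y · b^{P}` then the `a`-chain `f` of `y` satisfies
`f (γ h) = f h` for all `h` (`b`-powers carry no `a`-chain). [cite: LyndonSchupp2001, Ch. II §3] -/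
theorem fox_fst_comp_eq_of_shear_eq_mul_bPow [Fintype G] (hΦa : Φ genA = wa α) (hΦb : Φ genB = wb β) (κ P : ZH)
    (γ : G ≃* G) (n : ℕ) (hγa : γ α = α * β ^ n) (hγb : γ β = β) (hκ : Φ (bPow κ) = wb β ^ n)
    {y : F₂hatT} (hy : shearEnd κ y = y * bPow P) (h : G) :
    (Multiplicative.toAdd (Φ y).left).1 (γ h) = (Multiplicative.toAdd (Φ y).left).1 h := by
  set f := (Multiplicative.toAdd (Φ y).left).1 with hfdef
  have h1 : mapW γ.toMonoidHom (thetaHom (α * (β ^ n)⁻¹) β n (Φ y)) = Φ y * Φ (bPow P) := by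
    rw [← fox_shearEnd_eq hΦa hΦb κ γ.toMonoidHom n (by exact hγa) (by exact hγb) hκ y, hy, map_mul]
  have h0 := congrArg (fun w : W G k => (Multiplicative.toAdd w.left).1) h1
  have hL : (Multiplicative.toAdd (mapW γ.toMonoidHom (thetaHom (α * (β ^ n)⁻¹) β n (Φ y))).left).1 =
      push (⇑γ) f := by
    rw [toAdd_mapW_left]
    show push (⇑γ.toMonoidHom) (Multiplicative.toAdd (thetaHom (α * (β ^ n)⁻¹) β n (Φ y)).left).1 = _
    rw [thetaHom_fst]
    rfl
  have hR : (Multiplicative.toAdd (Φ y * Φ (bPow P)).left).1 = f := by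
    rw [SemidirectProduct.mul_left, toAdd_mul, toAdd_foxAct, Prod.fst_add, fox_bPow_fst_eq_zero hΦb P, lt_zero,
      add_zero]
  have hf : push (⇑γ) f = f := (hL.symm.trans h0).trans hR
  have h2 := congrFun hf (γ h)
  rw [← h2]
  exact push_apply_of_injective (⇑γ) γ.injective f h

/-! ### Read-outs of the fundamental formula summed over the coset `x̄⟨β⟩` -/

/-- **Read-out 1: a vanishing `a`-chain forces `x̄ ∈ ⟨β⟩`** (sum the fundamental formula over the coset `x̄⟨β⟩`;
the `b`-part cancels, leaving `1 - [1 ∈ x̄⟨β⟩] = 0`). [cite: LyndonSchupp2001, Ch. II §3] -/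
theorem right_mem_zpowers_of_fst_eq_zero [Fintype G] [Nontrivial k] (hΦa : Φ genA = wa α) (hΦb : Φ genB = wb β) (x : F₂hatT)
    (hf : (Multiplicative.toAdd (Φ x).left).1 = 0) : (Φ x).right ∈ Subgroup.zpowers β := by
  classical
  set X := (Φ x).right with hX
  obtain ⟨S, hS, hSβ⟩ := exists_coset_finset X β
  have hbd := fox_bd_eq hΦa hΦb x
  rw [hf, rt_zero, sub_zero, zero_add] at hbd
  have h := congrArg (csum S) hbd
  rw [map_sub, map_sub, csum_rt S S β hSβ, sub_self, csum_e, csum_e, if_pos ((hS X).2 (by simp))] at h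
  by_contra hXβ
  have h1 : (1 : G) ∉ S := by
    rw [hS, mul_one]
    exact fun h1 => hXβ (by simpa using Subgroup.inv_mem _ h1)
  rw [if_neg h1, sub_zero] at h
  exact one_ne_zero h.symm

/-- **Read-out 2: an `a`-chain vanishing OFF a subgroup `Q ∋ β` forces `x̄ ∈ Q ∪ Q α ⟨β⟩** (summing over `x̄⟨β⟩`:
if `x̄ ∉ Q` and `x̄ β^j α⁻¹ ∉ Q` for all `j`, both `a`-sums vanish and `1 = 0`). [cite: LyndonSchupp2001, Ch. II §3] -/
theorem right_mem_or_exists_of_fst_eq_zero_off [Fintype G] [Nontrivial k] (hΦa : Φ genA = wa α) (hΦb : Φ genB = wb β)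
    (Q : Subgroup G) (hβ : β ∈ Q) (x : F₂hatT)
    (hf : ∀ h, h ∉ Q → (Multiplicative.toAdd (Φ x).left).1 h = 0) :
    (Φ x).right ∈ Q ∨ ∃ q₀ ∈ Q, ∃ j : ℤ, (Φ x).right = q₀ * α * β ^ j := by
  classical
  set X := (Φ x).right with hX
  set f := (Multiplicative.toAdd (Φ x).left).1 with hfdef
  by_cases hXQ : X ∈ Q
  · exact Or.inl hXQ
  by_cases hex : ∃ q₀ ∈ Q, ∃ j : ℤ, X = q₀ * α * β ^ j
  · exact Or.inr hex
  exfalso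
  have hne : ∀ q₀ ∈ Q, ∀ j : ℤ, X ≠ q₀ * α * β ^ j := fun q₀ hq₀ j heq => hex ⟨q₀, hq₀, j, heq⟩
  obtain ⟨S, hS, hSβ⟩ := exists_coset_finset X β
  -- members of `S` are `X β^j`
  have memS : ∀ q ∈ S, ∃ j : ℤ, q = X * β ^ j := by
    intro q hq
    obtain ⟨j, hj⟩ := Subgroup.mem_zpowers_iff.mp ((hS q).1 hq)
    exact ⟨j, by rw [hj, mul_inv_cancel_left]⟩
  have hsum1 : csum S f = 0 := by
    rw [csum_apply]
    refine Finset.sum_eq_zero fun q hq => hf q fun hqQ => ?_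
    obtain ⟨j, rfl⟩ := memS q hq
    apply hXQ
    have := Q.mul_mem hqQ (Q.zpow_mem hβ (-j))
    rwa [mul_assoc, ← zpow_add, add_neg_cancel, zpow_zero, mul_one] at this
  have hsum2 : csum S (rt α f) = 0 := by
    rw [csum_apply]
    refine Finset.sum_eq_zero fun q hq => ?_
    rw [rt_apply]
    refine hf _ fun hqQ => ?_
    obtain ⟨j, rfl⟩ := memS q hq
    refine hne (X * β ^ j * α⁻¹) hqQ (-j) ?_
    rw [zpow_neg]
    group
  have hbd := fox_bd_eq hΦa hΦb x
  have h := congrArg (csum S) hbd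
  rw [map_add, map_sub, map_sub, map_sub, csum_rt S S β hSβ, sub_self, add_zero, ← hfdef, hsum1, hsum2, sub_self,
    csum_e, csum_e, ← hX, if_pos ((hS X).2 (by simp))] at h
  have h1 : (1 : G) ∉ S := by
    rw [hS, mul_one]
    intro h1
    apply hXQ
    have hXz : X ∈ Subgroup.zpowers β := by simpa using Subgroup.inv_mem _ h1
    exact (Subgroup.zpowers_le.mpr hβ) hXz
  rw [if_neg h1, sub_zero] at h
  exact one_ne_zero h.symm

end Level

end Literature.AnabelianGeometry.AbsoluteAnabelian.AbsTopII.DehnTwist
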